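import Summits.AnomalousDissipation.AnomalousDissipation.Theorems.KolmogorovFloor.Negative.BelowTaylorSupport

/-!
# CHEAP bookkeeping of the line `digit-frame-closure` — the numeric choices and their elementary facts
(negative side of `TaylorCertificates.KolmogorovFloor`, crux stmt-AnomalousDissipation-15122)

cdisprove seat `refuter-cdisprove-stmt-AnomalousDissipation-15122-0` (2026-08-16). Pure real analysis, file 1 of the
CHEAP bookkeeping (`ResponseStatement → CheapStatesStatement`): the choices of the truncation level `L`, the line
truncation `J` and the shear amplitude `s` as functions of the small parameter `η`, and their elementary facts.
With `r = 10 + 3p` (the exponent budget of the worst frame/response product `X2e2·Cb³`):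
`Λ = η^{-1/(40r)}`, `L = ⌊(Λ−1)/2⌋` (so `(2L+1)^n ≤ η^{-1/40}` for `n ≤ r`, `1 + L² ≥ Λ²/13`; `levelL_facts`),
the tail majorant `K S₃ (1+L²)^{-41r} ≤ η²` once `K S₃ 13^{41r} η^{1/20} ≤ 1` (`tailMajorant_le_sq`),
`J = ⌈√(3Cb/η)⌉` (`3Cb/η ≤ (J+1)² ≤ 9Cb/η + 6`, `2J+1 ≤ (2√(3a)+3)η⁻¹` when `Cb ≤ a η^{-1/40}`; `truncJ_facts`),
`ℓ = 1 + log(2J+1) ≤ (1 + 80 C_J^{1/80}) η^{-1/80}` (`Real.log_le_rpow_div`; `logFactor_le`),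
`s = √(η^{-11/10}/(8π² X2e2))`.
-/

noncomputable section

set_option linter.dupNamespace false

open Real

namespace Summit.AnomalousDissipation.AnomalousDissipation.Theorems.KolmogorovFloor.Negative

/-! ### The choices -/

/-- The exponent budget `r = 10 + 3p` of the worst frame/response product `X2e2·Cb³`. -/
def expoR (p : ℕ) : ℕ := 10 + 3 * p

/-- The frame size parameter `Λ = η^{-1/(40 r)}` (so that `Λ^r = η^{-1/40}`). -/
def levelΛ (p : ℕ) (η : ℝ) : ℝ := η ^ (-(1 / (40 * (expoR p : ℝ))))

/-- The truncation level `L = ⌊(Λ − 1)/2⌋`, i.e. `2L + 1 ≤ Λ < 2L + 3`. -/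
def levelL (p : ℕ) (η : ℝ) : ℕ := ⌊(levelΛ p η - 1) / 2⌋₊

/-- The order of polynomial Fourier decay used: `m = 41 r + 3`. -/
def decayOrder (p : ℕ) : ℕ := 41 * expoR p + 3

/-- The tail majorant `K S₃ (1 + L²)^{-41 r}`. -/
def tailMajorant (p : ℕ) (K S₃ η : ℝ) : ℝ := K * S₃ * ((1 + (levelL p η : ℝ) ^ 2) ^ (41 * expoR p))⁻¹

/-- The truncation index `J = ⌈√(3 Cb/η)⌉` (so that the edge defect `Cb/(J+1)² ≤ η/3`). -/
def truncJ (Cb η : ℝ) : ℕ := ⌈Real.sqrt (3 * Cb / η)⌉₊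

/-- The logarithmic factor `ℓ = 1 + log(2J + 1)` of the response bounds. -/
def logFactor (Cb η : ℝ) : ℝ := 1 + Real.log (2 * (truncJ Cb η : ℝ) + 1)

/-- The shear amplitude `s = √(η^{-11/10}/(8π²Pr))` (half the enstrophy budget goes to the shear), `Pr = X2·e2`. -/
def ampS (Pr η : ℝ) : ℝ := Real.sqrt (η ^ (-(11 / 10 : ℝ)) / (8 * Real.pi ^ 2 * Pr))

/-! ### Small real lemmas -/

/-- `(η^{-θ})^n = η^{-θ n}`. -/
theorem rpow_neg_natPow {η θ : ℝ} (hη : 0 < η) (n : ℕ) : (η ^ (-θ)) ^ n = η ^ (-(θ * n)) := by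
  rw [← Real.rpow_natCast, ← Real.rpow_mul hη.le]; ring_nf

/-- Absorbing a constant into a spare power: from `η^γ ≤ 1/(C+1)` get `C·η^γ ≤ 1` (`C ≥ 0`). -/
theorem const_mul_rpow_le_one {C η γ : ℝ} (hC : 0 ≤ C) (hη : 0 < η) (h : η ^ γ ≤ 1 / (C + 1)) :
    C * η ^ γ ≤ 1 := by
  have h0 : 0 ≤ η ^ γ := Real.rpow_nonneg hη.le _
  rw [le_div_iff₀ (by linarith)] at h
  nlinarith

/-- `2√x ≤ x + 1`. -/
theorem two_sqrt_le (x : ℝ) (hx : 0 ≤ x) : 2 * Real.sqrt x ≤ x + 1 := by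
  nlinarith [Real.sq_sqrt hx, sq_nonneg (Real.sqrt x - 1), Real.sqrt_nonneg x]

/-! ### The level `L` -/

/-- **Facts about the level.** For `0 < η` with `η^{1/(40r)} ≤ 1/5`: `L ≥ 1`, `1 ≤ 2L+1`,
`(2L+1)^n ≤ η^{-1/40}` for every `n ≤ r`, and `1 + L² ≥ (η^{-1/(40r)})²/13`. -/
theorem levelL_facts (p : ℕ) {η : ℝ} (hη : 0 < η)
    (hsmall : η ^ (1 / (40 * (expoR p : ℝ))) ≤ 1 / 5) :
    1 ≤ levelL p η ∧ (1 : ℝ) ≤ 2 * (levelL p η : ℝ) + 1 ∧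
      (∀ n : ℕ, n ≤ expoR p → (2 * (levelL p η : ℝ) + 1) ^ n ≤ η ^ (-(1 / 40 : ℝ))) ∧
      (η ^ (-(1 / (40 * (expoR p : ℝ))))) ^ 2 / 13 ≤ 1 + (levelL p η : ℝ) ^ 2 := by
  obtain ⟨r, hr⟩ : ∃ r : ℕ, r = expoR p := ⟨_, rfl⟩
  have hr10 : 10 ≤ r := by rw [hr, expoR]; omega
  have hrpos : (0 : ℝ) < r := by exact_mod_cast (lt_of_lt_of_le (by norm_num) hr10)
  have hr0 : (r : ℝ) ≠ 0 := hrpos.ne'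
  rw [← hr] at hsmall ⊢
  obtain ⟨θ, hθ⟩ : ∃ θ : ℝ, θ = 1 / (40 * (r : ℝ)) := ⟨_, rfl⟩
  rw [← hθ] at hsmall ⊢
  obtain ⟨Λ, hΛ⟩ : ∃ Λ : ℝ, Λ = η ^ (-θ) := ⟨_, rfl⟩
  have hΛ5 : 5 ≤ Λ := by
    rw [hΛ, Real.rpow_neg hη.le, le_inv_comm₀ (by norm_num) (Real.rpow_pos_of_pos hη _)]
    exact hsmall.trans (by norm_num)
  have hΛ1 : 1 ≤ Λ := by linarith only [hΛ5]
  have hΛr : Λ ^ r = η ^ (-(1 / 40 : ℝ)) := by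
    rw [hΛ, rpow_neg_natPow hη, hθ]
    congr 1
    field_simp
  obtain ⟨L, hL⟩ : ∃ L : ℕ, L = levelL p η := ⟨_, rfl⟩
  have hLdef : (L : ℝ) = ⌊(Λ - 1) / 2⌋₊ := by rw [hL, levelL, levelΛ, ← hr, ← hθ, ← hΛ]
  have hLle : (L : ℝ) ≤ (Λ - 1) / 2 := by rw [hLdef]; exact Nat.floor_le (by linarith only [hΛ1])
  have hLgt : (Λ - 1) / 2 < (L : ℝ) + 1 := by rw [hLdef]; exact Nat.lt_floor_add_one _
  have hB : 2 * (L : ℝ) + 1 ≤ Λ := by linarith only [hLle]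
  have hL0 : (0 : ℝ) ≤ L := Nat.cast_nonneg L
  have hL1 : 1 ≤ L := by
    have : (1 : ℝ) ≤ (L : ℝ) := by linarith only [hLgt, hΛ5]
    exact_mod_cast this
  rw [← hL, ← hΛ]
  refine ⟨hL1, by linarith only [hL0], fun n hn => ?_, ?_⟩
  · calc (2 * (L : ℝ) + 1) ^ n ≤ Λ ^ n := pow_le_pow_left₀ (by linarith only [hL0]) hB n
      _ ≤ Λ ^ r := pow_le_pow_right₀ hΛ1 hn
      _ = η ^ (-(1 / 40 : ℝ)) := hΛr
  · have h1 : Λ ≤ 2 * (L : ℝ) + 3 := by linarith only [hLgt]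
    have h2 : Λ ^ 2 ≤ (2 * (L : ℝ) + 3) ^ 2 := pow_le_pow_left₀ (by linarith only [hΛ1]) h1 2
    have h3 : (2 * (L : ℝ) + 3) ^ 2 ≤ 13 * (1 + (L : ℝ) ^ 2) := by
      nlinarith only [sq_nonneg (3 * (L : ℝ) - 2), hL0]
    rw [div_le_iff₀ (by norm_num)]; linarith only [h2, h3]

/-! ### The tail majorant -/

/-- **The tail majorant is `≤ η²`** once `1 + L² ≥ Λ²/13` and `K S₃ 13^{41r} η^{1/20} ≤ 1`. -/
theorem tailMajorant_le_sq (p : ℕ) {K S₃ η : ℝ} (hK : 0 ≤ K) (hS : 0 ≤ S₃) (hη : 0 < η)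
    (hL2 : (η ^ (-(1 / (40 * (expoR p : ℝ))))) ^ 2 / 13 ≤ 1 + (levelL p η : ℝ) ^ 2)
    (ha3 : K * S₃ * (13 : ℝ) ^ (41 * expoR p) * η ^ (1 / 20 : ℝ) ≤ 1) :
    0 ≤ tailMajorant p K S₃ η ∧ tailMajorant p K S₃ η ≤ η ^ 2 := by
  obtain ⟨r, hr⟩ : ∃ r : ℕ, r = expoR p := ⟨_, rfl⟩
  have hr10 : 10 ≤ r := by rw [hr, expoR]; omega
  have hrpos : (0 : ℝ) < r := by exact_mod_cast (lt_of_lt_of_le (by norm_num) hr10)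
  have hr0 : (r : ℝ) ≠ 0 := hrpos.ne'
  rw [← hr] at hL2 ha3
  obtain ⟨L, hL⟩ : ∃ L : ℕ, L = levelL p η := ⟨_, rfl⟩
  rw [← hL] at hL2
  have hTsdef : tailMajorant p K S₃ η = K * S₃ * ((1 + (L : ℝ) ^ 2) ^ (41 * r))⁻¹ := by
    rw [tailMajorant, ← hL, ← hr]
  rw [hTsdef]
  refine ⟨by positivity, ?_⟩
  obtain ⟨Λ, hΛ⟩ : ∃ Λ : ℝ, Λ = η ^ (-(1 / (40 * (r : ℝ)))) := ⟨_, rfl⟩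
  rw [← hΛ] at hL2
  have hΛ0 : 0 < Λ := by rw [hΛ]; exact Real.rpow_pos_of_pos hη _
  have h1 : (Λ ^ 2 / 13) ^ (41 * r) ≤ (1 + (L : ℝ) ^ 2) ^ (41 * r) := pow_le_pow_left₀ (by positivity) hL2 _
  have h2 : (Λ ^ 2 / 13) ^ (41 * r) = η ^ (-(41 / 20 : ℝ)) / (13 : ℝ) ^ (41 * r) := by
    rw [div_pow]
    congr 1
    rw [← pow_mul, hΛ, rpow_neg_natPow hη]
    congr 1
    push_cast
    field_simp
    ring
  have hpos : 0 < η ^ (-(41 / 20 : ℝ)) / (13 : ℝ) ^ (41 * r) := by positivity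
  have h3 : ((1 + (L : ℝ) ^ 2) ^ (41 * r))⁻¹ ≤ (13 : ℝ) ^ (41 * r) * η ^ (41 / 20 : ℝ) := by
    rw [h2] at h1
    calc ((1 + (L : ℝ) ^ 2) ^ (41 * r))⁻¹ ≤ (η ^ (-(41 / 20 : ℝ)) / (13 : ℝ) ^ (41 * r))⁻¹ := inv_anti₀ hpos h1
      _ = (13 : ℝ) ^ (41 * r) * η ^ (41 / 20 : ℝ) := by
          rw [inv_div, Real.rpow_neg hη.le, div_inv_eq_mul]
  have h4 := mul_le_mul_of_nonneg_left h3 (by positivity : 0 ≤ K * S₃)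
  have h5 : η ^ (41 / 20 : ℝ) = η ^ (1 / 20 : ℝ) * η ^ 2 := by
    rw [← Real.rpow_natCast, ← Real.rpow_add hη]; norm_num
  rw [h5] at h4
  have h6 : 0 ≤ η ^ 2 := by positivity
  have h7 : K * S₃ * ((13 : ℝ) ^ (41 * r) * (η ^ (1 / 20 : ℝ) * η ^ 2)) =
      (K * S₃ * (13 : ℝ) ^ (41 * r) * η ^ (1 / 20 : ℝ)) * η ^ 2 := by ring
  rw [h7] at h4
  have h8 : (K * S₃ * (13 : ℝ) ^ (41 * r) * η ^ (1 / 20 : ℝ)) * η ^ 2 ≤ 1 * η ^ 2 :=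
    mul_le_mul_of_nonneg_right ha3 h6
  linarith only [h4, h8]

/-! ### The truncation index `J` -/

/-- **Facts about `J = ⌈√(3Cb/η)⌉`**: with `Jr = J + 1`, `3Cb/η ≤ Jr²`, `Jr² ≤ 9Cb/η + 6`, and
`2J + 1 ≤ (2√(3a) + 3)·η⁻¹` whenever `Cb ≤ a·Q` with `Q ≤ η⁻¹`. -/
theorem truncJ_facts {Cb η a Q : ℝ} (hCb0 : 0 ≤ Cb) (hη : 0 < η) (hη1 : η ≤ 1) (ha0 : 0 ≤ a)
    (heCb : Cb ≤ a * Q) (hQle : Q ≤ η⁻¹) :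
    3 * Cb / η ≤ ((truncJ Cb η : ℝ) + 1) ^ 2 ∧ ((truncJ Cb η : ℝ) + 1) ^ 2 ≤ 9 * Cb / η + 6 ∧
      2 * (truncJ Cb η : ℝ) + 1 ≤ (2 * Real.sqrt (3 * a) + 3) * η⁻¹ := by
  obtain ⟨J, hJ⟩ : ∃ J : ℕ, J = truncJ Cb η := ⟨_, rfl⟩
  rw [← hJ]
  have hx0 : 0 ≤ 3 * Cb / η := by positivity
  have hJge : Real.sqrt (3 * Cb / η) ≤ (J : ℝ) := by rw [hJ, truncJ]; exact Nat.le_ceil _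
  have hJlt : (J : ℝ) < Real.sqrt (3 * Cb / η) + 1 := by
    rw [hJ, truncJ]; exact Nat.ceil_lt_add_one (Real.sqrt_nonneg _)
  have hJ0 : (0 : ℝ) ≤ J := Nat.cast_nonneg J
  have hsx := Real.sq_sqrt hx0
  have hsx0 := Real.sqrt_nonneg (3 * Cb / η)
  refine ⟨?_, ?_, ?_⟩
  · have h2 : Real.sqrt (3 * Cb / η) ≤ (J : ℝ) + 1 := by linarith only [hJge]
    calc 3 * Cb / η = Real.sqrt (3 * Cb / η) ^ 2 := hsx.symm
      _ ≤ ((J : ℝ) + 1) ^ 2 := pow_le_pow_left₀ hsx0 h2 2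
  · have h2 := two_sqrt_le (3 * Cb / η) hx0
    have hJrle : (J : ℝ) + 1 ≤ Real.sqrt (3 * Cb / η) + 2 := by linarith only [hJlt]
    have h3 : ((J : ℝ) + 1) ^ 2 ≤ (Real.sqrt (3 * Cb / η) + 2) ^ 2 :=
      pow_le_pow_left₀ (by linarith only [hJ0]) hJrle 2
    have h4 : (Real.sqrt (3 * Cb / η) + 2) ^ 2 =
        Real.sqrt (3 * Cb / η) ^ 2 + 4 * Real.sqrt (3 * Cb / η) + 4 := by ring
    have h5 : (9 : ℝ) * Cb / η = 3 * (3 * Cb / η) := by ring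
    rw [h4, hsx] at h3
    rw [h5]
    linarith only [h3, h2]
  · have hηinv1 : (1 : ℝ) ≤ η⁻¹ := (one_le_inv₀ hη).2 hη1
    have hsqrt_le : Real.sqrt (3 * Cb / η) ≤ Real.sqrt (3 * a) * η⁻¹ := by
      have h1 : 3 * Cb / η ≤ (3 * a) * (Q / η) := by
        rw [div_eq_mul_inv, div_eq_mul_inv]
        have := mul_le_mul_of_nonneg_right heCb (inv_pos.2 hη).le
        linarith only [this]
      have h2 : Q / η ≤ η⁻¹ ^ 2 := by
        rw [div_eq_mul_inv, sq]
        exact mul_le_mul_of_nonneg_right hQle (by positivity)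
      have h3 : (3 * a) * (Q / η) ≤ (3 * a) * η⁻¹ ^ 2 := mul_le_mul_of_nonneg_left h2 (by positivity)
      calc Real.sqrt (3 * Cb / η) ≤ Real.sqrt ((3 * a) * η⁻¹ ^ 2) := Real.sqrt_le_sqrt (h1.trans h3)
        _ = Real.sqrt (3 * a) * η⁻¹ := by
            rw [Real.sqrt_mul (by positivity), Real.sqrt_sq (by positivity)]
    have h1 : (2 * Real.sqrt (3 * a) + 3) * η⁻¹ = 2 * (Real.sqrt (3 * a) * η⁻¹) + 3 * η⁻¹ := by ring
    rw [h1]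
    linarith only [hJlt, hsqrt_le, hηinv1]

/-! ### The logarithmic factor -/

/-- **The logarithmic factor** `ℓ = 1 + log(2J+1)` satisfies `1 ≤ ℓ` and `ℓ ≤ (1 + 80 CJ^{1/80}) η^{-1/80}`
whenever `2J + 1 ≤ CJ·η⁻¹` (`Real.log_le_rpow_div`). -/
theorem logFactor_le {Cb η CJ : ℝ} (hη : 0 < η) (hη1 : η ≤ 1) (hCJ0 : 0 ≤ CJ)
    (h2J1 : 2 * (truncJ Cb η : ℝ) + 1 ≤ CJ * η⁻¹) :
    1 ≤ logFactor Cb η ∧ logFactor Cb η ≤ (1 + 80 * CJ ^ (1 / 80 : ℝ)) * η ^ (-(1 / 80 : ℝ)) := by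
  obtain ⟨J, hJ⟩ : ∃ J : ℕ, J = truncJ Cb η := ⟨_, rfl⟩
  rw [← hJ] at h2J1
  have hℓdef : logFactor Cb η = 1 + Real.log (2 * (J : ℝ) + 1) := by rw [logFactor, ← hJ]
  have hJ0 : (0 : ℝ) ≤ J := Nat.cast_nonneg J
  have h2J1pos : 0 < 2 * (J : ℝ) + 1 := by linarith only [hJ0]
  have hlog0 : 0 ≤ Real.log (2 * (J : ℝ) + 1) := Real.log_nonneg (by linarith only [hJ0])
  rw [hℓdef]
  refine ⟨by linarith only [hlog0], ?_⟩
  have h80 : (1 : ℝ) ≤ η ^ (-(1 / 80 : ℝ)) := Real.one_le_rpow_of_pos_of_le_one_of_nonpos hη hη1 (by norm_num)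
  have h1 : Real.log (2 * (J : ℝ) + 1) ≤ (2 * (J : ℝ) + 1) ^ (1 / 80 : ℝ) / (1 / 80 : ℝ) :=
    Real.log_le_rpow_div h2J1pos.le (by norm_num)
  rw [le_div_iff₀ (by norm_num)] at h1
  have h2 : (2 * (J : ℝ) + 1) ^ (1 / 80 : ℝ) ≤ (CJ * η⁻¹) ^ (1 / 80 : ℝ) :=
    Real.rpow_le_rpow h2J1pos.le h2J1 (by norm_num)
  have h3 : (CJ * η⁻¹) ^ (1 / 80 : ℝ) = CJ ^ (1 / 80 : ℝ) * η ^ (-(1 / 80 : ℝ)) := by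
    rw [Real.mul_rpow hCJ0 (by positivity), Real.inv_rpow hη.le, ← Real.rpow_neg hη.le]
  rw [h3] at h2
  have h4 : Real.log (2 * (J : ℝ) + 1) ≤ 80 * (CJ ^ (1 / 80 : ℝ) * η ^ (-(1 / 80 : ℝ))) := by linarith only [h1, h2]
  have h5 : (1 + 80 * CJ ^ (1 / 80 : ℝ)) * η ^ (-(1 / 80 : ℝ)) =
      η ^ (-(1 / 80 : ℝ)) + 80 * (CJ ^ (1 / 80 : ℝ) * η ^ (-(1 / 80 : ℝ))) := by ring
  rw [h5]
  linarith only [h4, h80]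

/-- **The amplitude**: `s = ampS Pr η > 0`, `s² = η^{-11/10}/(8π²Pr)`, `(s⁻¹)² = 8π² Pr η^{11/10}`. -/
theorem ampS_facts {Pr η : ℝ} (hPr : 0 < Pr) (hη : 0 < η) :
    0 < ampS Pr η ∧ ampS Pr η ^ 2 = η ^ (-(11 / 10 : ℝ)) / (8 * Real.pi ^ 2 * Pr) ∧
      (ampS Pr η)⁻¹ ^ 2 = 8 * Real.pi ^ 2 * Pr * η ^ (11 / 10 : ℝ) := by
  have hs2 : ampS Pr η ^ 2 = η ^ (-(11 / 10 : ℝ)) / (8 * Real.pi ^ 2 * Pr) := by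
    rw [ampS, Real.sq_sqrt (by positivity)]
  refine ⟨Real.sqrt_pos.2 (by positivity), hs2, ?_⟩
  rw [inv_pow, hs2, inv_div, Real.rpow_neg hη.le, div_inv_eq_mul]

end Summit.AnomalousDissipation.AnomalousDissipation.Theorems.KolmogorovFloor.Negative
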